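import Summits.QuantumFields.BalabanUV.Beta.D1BFx.LandauDictionaryH

/-!
# Road BF-x, slot (K) dictionary brick B6 (DICT-H), part 3: THE OWNER's RULING ρ-g5-5 — the vector-leg equation X₁a SOLVED FOR `S A` WITH
# THREE FREE COEFFICIENTS `(c, r, a′)` (truth for `Ga = Kinf`: `r = 2`, `a′ = 2a∕n⁸`, `c = 2`), gauge multiplier `μ := −(r·n²)·G′R(δA)`

HONEST DEPENDENCY (page 1, mandatory): continuum YM on T⁴ ⇐ BetaPertH ∧ nine spine estimates (0/9 proved); BetaPertH ⇐ (D1) ∧ (D4) ∧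
CAP+tail; G-an2-4 gates asym, D1 and NE2/3/4.  HONEST FRAMING (cell contract, verbatim): «discharging `BetaPertH` makes Bałaban's UV
stability UNCONDITIONAL — a real constructive-QFT result; it is NOT the continuum limit and NOT the Clay problem.»  THIS MODULE re-issues
part 2 (`LandauDictionaryH`: `el_superposed`, `solvesKKT_superposed`, `wH_eq_HRcol` — the `r = 1` pattern of `DICT-BRICKS.md` v1.1) in the
shape RULED by the road owner AFTER part 2 was written (ρ-g5-5, journal 2026-08-20T18:40Z, `DICT-BRICKS.md` v1.2): an2's `curv` runs over all
ORDERED pairs, so `½·curvAdj∘curv + dz∘codiff₁ = −Δ`; the equation `Ga = Kinf` can satisfy has curl-curl : gauge ratio `1 : 2`, hence the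
displayed hypothesis must carry a free weight `r` on the gauge term.  [folklore] assembly BY NAME over parts 1–2 and bricks B1∕B3∕B4∕B5; no
`def`, no `def … : Prop`, nothing cited, 0 sorry.  X₁a DISPLAYED, NOT asserted (the owner's `X1-SPEC.md`).  0∕4 binders of row D1 discharged;
NOT D1, NOT BetaPertH, NOT continuum, NOT Clay.

ABSOLUTE RULE (cell charter, verbatim): «No internally-minted statement may enter as a cited fact. Every hypothesis is either kernel-proved
in this package or a verbatim quotation of a PUBLISHED theorem with page reference. The manuscript(s) under audit are NOT citable for their
own disputed steps — they are the thing under adjudication; programme-internal (2001/route/tribunal) claims are never citable.»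

CONTENT (hypothesis `hX1a : ∀ m z κ x, curvAdj (curv (Ga e_{(m,z)})) κ x = c·δ_{(m,z)} κ x − r·dz (Rf n a (codiff₁ (Ga e_{(m,z)}))) κ x
− a′·𝒬ᵀ𝒬(Ga e_{(m,z)}) κ x`).
* §1 **`el_superposed_w`** (the same for `A := kerOp₁ Ga b`, any bounded weight `b`, right side `c·b`).
* §2 **`solvesKKT_superposed_w`** (`r ≠ 0`; `SolvesKKT n 0 (𝒬A) A (c•ω − a′•𝒬A) (−(r·n²)·Gf (Rf (δA)))` from X₁a ALONE), `tempered_superposed_w`.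
* §3 **`wH_eq_HRcol_w`**: with (X₁b) `𝒬(HRcol) = δ_{(l,0)}` — `wH(·;l) = HRcol n Ga Cun l 0`, `wΦ(·;l) = c•Cun(·,0;·,l) − a′•δ`, `wM l = r • muCol n a Ga Cun l 0`.
Unit `b2b-balaban-beta-d1-formalise-leaf-06` (gen 6), 2026-08-20; `DICT-BRICKS.md` row B6 (v1.2 shape).
-/

namespace Summit.QuantumFields.BalabanUV.Beta.D1BFx.LandauDictionaryHWeighted

open Finset
open scoped BigOperators
open Literature.MathematicalPhysics.QuantumFieldTheory.Balaban1983to89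
open Literature.MathematicalPhysics.QuantumFieldTheory.Balaban1983to89.Beta
open ExpKernelCalculus (Site MKer Decays Zl Zl_nonneg)
open B12Sec2to5 (l1 l1_nonneg)
open AffineAveraging (Form0 Form1 box toSite unitVec dz curv curvAdj codiff₁ blockSum contourSum)
open AffineReproduction (contourSumAdj IsBlockConst codiff₁_sub dz_sub)
open KKTFluctuationKernel (delta1 delta1_apply)
open KKTFluctuationUnique (SolvesKKT Tempered0 Tempered1 eq_wH_of_solvesKKT)
open KernelSpecInstance (wH wΦ wM hasSum_contourSumAdj codiff₁_smul dz_smul)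
open ResolventComposition (codiff₁_curvAdj isBlockConst_codiff₁_contourSumAdj)
open Summit.QuantumFields.BalabanUV.Beta.TameKernelCalculus (Spr)
open GhostLeg (Ggh)
open RProjector (Pgt)
open RProjectorJet (RG)
open KernelFormOperators (kerOp kerOp₁ Pf Rf Rf_eq abs_kerOp₁_le hasSum_curvAdj_curv_kerOp₁ hasSum_contourSum_kerOp₁)
open TowerEquationForms (Gf)
open ProjectorGaugeBlockConst (isBlockConst_codiff₁_dz_Pf)
open LandauDictionaryHOps (codiff₁_superpos dz_superpos₀ Rf_superpos opEL_superpos' QtQ_superpos delta1_superpos abs_codiff₁_le_of_bound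
  abs_col_le hasSum_dz_Rf_codiff₁_superpos codiff₁_dz_neg_sq_Gf_Rf blockSum_neg_sq_Gf_Rf exists_bound_neg_sq_Gf_Rf)
open LandauDictionaryH (HRcol muCol abs_contourSumAdj_le abs_Cun_le isBlockConst_comb muCol_eq)

noncomputable section

variable (n : ℕ) [NeZero n] (a : ℝ)

/-! ## §1 X₁a (ρ-g5-5 shape) superposed over the source bonds -/

section Superposed

variable {Ga : MKer 4 (Fin 4)} {C δ M : ℝ} {b : Form1 4 ℝ} {r a' c : ℝ}

/-- [folklore] **X₁a SUPERPOSED, WEIGHTED SHAPE**: if every column `Ga e_{(m,z)}` satisfies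
`S(Ga e) = c·e − r·d(R δ(Ga e)) − a′·𝒬ᵀ𝒬(Ga e)`, then `A := kerOp₁ Ga b` satisfies `S A = c·b − r·d(R δA) − a′·𝒬ᵀ𝒬A` (bounded `b`). -/
theorem el_superposed_w (ha : 0 < a) (hGa : Decays Ga C δ) (hδ : 0 < δ) (hb : ∀ l z, |b l z| ≤ M)
    (hX1a : ∀ (m : Fin 4) (z : Site 4) (κ : Fin 4) (x : Site 4),
      curvAdj (curv (fun κ' p => Ga p z κ' m)) κ x = c * delta1 m z κ x - r * dz (Rf n a (codiff₁ (fun κ' p => Ga p z κ' m))) κ x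
        - a' * contourSumAdj n (contourSum n (fun κ' p => Ga p z κ' m)) κ x)
    (κ : Fin 4) (x : Site 4) :
    curvAdj (curv (kerOp₁ Ga b)) κ x = c * b κ x - r * dz (Rf n a (codiff₁ (kerOp₁ Ga b))) κ x
      - a' * contourSumAdj n (contourSum n (kerOp₁ Ga b)) κ x := by
  have h1 := hasSum_curvAdj_curv_kerOp₁ hGa hδ hb κ x
  have h2 := (hasSum_dz_Rf_codiff₁_superpos n a ha hGa hδ hb κ x).mul_left r
  have h3 := (hasSum_contourSumAdj (N := n) (F := fun z : Site 4 => contourSum n (fun κ p => ∑ m, Ga p z κ m * b m z))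
    (φ := contourSum n (kerOp₁ Ga b)) (fun κ y => hasSum_contourSum_kerOp₁ hGa hδ hb n κ y) κ x).mul_left a'
  have h4 : HasSum (fun z : Site 4 => c * ∑ m, b m z * delta1 m z κ x) (c * b κ x) := by
    have h := hasSum_single (f := fun z : Site 4 => c * ∑ m, b m z * delta1 m z κ x) x (fun z hz => by
      simp only [delta1_superpos (fun m => b m z) z κ x, if_neg (Ne.symm hz), mul_zero])
    simp only [delta1_superpos (fun m => b m x) x κ x] at h
    exact h
  -- the right-hand side family and its sum
  have hR := (h4.sub h2).sub h3
  have hcol : ∀ m z q, |codiff₁ (fun κ' p => Ga p z κ' m) q| ≤ 8 * C := fun m z q =>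
    abs_codiff₁_le_of_bound (fun κ' p => abs_col_le hGa hδ.le m z κ' p) q
  have hterm : ∀ z : Site 4, curvAdj (curv (fun κ p => ∑ m, Ga p z κ m * b m z)) κ x
      = c * ∑ m, b m z * delta1 m z κ x - r * dz (Rf n a (codiff₁ (fun κ p => ∑ m, Ga p z κ m * b m z))) κ x
        - a' * contourSumAdj n (contourSum n (fun κ p => ∑ m, Ga p z κ m * b m z)) κ x := by
    intro z
    have eS := opEL_superpos' (fun m => fun κ' p => Ga p z κ' m) (fun m => b m z) κ x
    have eQ := QtQ_superpos n (fun m => fun κ' p => Ga p z κ' m) (fun m => b m z) κ x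
    have eδ : codiff₁ (fun κ p => ∑ m, Ga p z κ m * b m z) = fun q => ∑ m, b m z * codiff₁ (fun κ' p => Ga p z κ' m) q :=
      funext fun q => codiff₁_superpos (fun m => fun κ' p => Ga p z κ' m) (fun m => b m z) q
    have eR : dz (Rf n a (codiff₁ (fun κ p => ∑ m, Ga p z κ m * b m z))) κ x
        = ∑ m, b m z * dz (Rf n a (codiff₁ (fun κ' p => Ga p z κ' m))) κ x := by
      rw [eδ, show Rf n a (fun q => ∑ m, b m z * codiff₁ (fun κ' p => Ga p z κ' m) q)
        = fun p => ∑ m, b m z * Rf n a (codiff₁ (fun κ' p => Ga p z κ' m)) p from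
        funext fun p => Rf_superpos n a ha (fun m => codiff₁ (fun κ' p => Ga p z κ' m)) (fun m => b m z) (fun m q => hcol m z q) p,
        dz_superpos₀]
    rw [eS, eR, eQ, Finset.mul_sum, Finset.mul_sum, Finset.mul_sum, ← Finset.sum_sub_distrib, ← Finset.sum_sub_distrib]
    refine Finset.sum_congr rfl fun m _ => ?_
    rw [hX1a m z κ x]
    ring
  exact h1.unique (hR.congr_fun fun z => hterm z)

end Superposed

/-! ## §2 The general superposed column solves the typed KKT system (weighted shape, `r ≠ 0`) -/

section Solves

variable {r a' c : ℝ} {Ga : MKer 4 (Fin 4)} {C δ Mω : ℝ} {ω : Form1 4 ℝ}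

/-- [folklore] **`SolvesKKT n 0 (𝒬A) A (c•ω − a′•𝒬A) (−(r·n²)·G′R(δA))` FROM X₁a (weighted shape) ALONE**, `A := Ga𝒬ᵀω`, `ω` bounded, `r ≠ 0`
(the gauge condition needs `r ≠ 0`: it reads `Δ₀(δA)` off the `r`-term). -/
theorem solvesKKT_superposed_w (ha : 0 < a) (hr : r ≠ 0) (hGa : Decays Ga C δ) (hδ : 0 < δ) (hω : ∀ κ y, |ω κ y| ≤ Mω)
    (hX1a : ∀ (m : Fin 4) (z : Site 4) (κ : Fin 4) (x : Site 4),
      curvAdj (curv (fun κ' p => Ga p z κ' m)) κ x = c * delta1 m z κ x - r * dz (Rf n a (codiff₁ (fun κ' p => Ga p z κ' m))) κ x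
        - a' * contourSumAdj n (contourSum n (fun κ' p => Ga p z κ' m)) κ x) :
    SolvesKKT n 0 (contourSum n (kerOp₁ Ga (contourSumAdj n ω))) (kerOp₁ Ga (contourSumAdj n ω))
      (fun κ y => c * ω κ y - a' * contourSum n (kerOp₁ Ga (contourSumAdj n ω)) κ y)
      (fun p => -(r * (n : ℝ) ^ 2) * Gf n a (Rf n a (codiff₁ (kerOp₁ Ga (contourSumAdj n ω)))) p) := by
  set b : Form1 4 ℝ := contourSumAdj n ω with hbdef
  have hb : ∀ m z, |b m z| ≤ n * Mω := fun m z => abs_contourSumAdj_le n hω m z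
  set A : Form1 4 ℝ := kerOp₁ Ga b with hAdef
  have hA : ∀ κ x, |A κ x| ≤ 4 * C * Zl 4 δ * (n * Mω) := fun κ x => abs_kerOp₁_le hGa hδ hb κ x
  set g : Form0 4 ℝ := codiff₁ A with hgdef
  have hg : ∀ q, |g q| ≤ 8 * (4 * C * Zl 4 δ * (n * Mω)) := fun q => abs_codiff₁_le_of_bound hA q
  have hE1 : ∀ κ x, curvAdj (curv A) κ x = c * b κ x - r * dz (Rf n a g) κ x - a' * contourSumAdj n (contourSum n A) κ x :=
    fun κ x => el_superposed_w n a ha hGa hδ hb hX1a κ x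
  -- the weighted multiplier is `r •` the unit one
  have hμr : (fun p => -(r * (n : ℝ) ^ 2) * Gf n a (Rf n a g) p) = r • (fun p => -((n : ℝ) ^ 2) * Gf n a (Rf n a g) p) := by
    funext p; simp only [Pi.smul_apply, smul_eq_mul]; ring
  have hΔμ : codiff₁ (dz (fun p => -(r * (n : ℝ) ^ 2) * Gf n a (Rf n a g) p)) = fun p => -(r * Rf n a g p) := by
    rw [hμr, dz_smul, codiff₁_smul]
    funext p
    rw [Pi.smul_apply, smul_eq_mul, codiff₁_dz_neg_sq_Gf_Rf n a ha hg p]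
    ring
  have hφ : ∀ κ x, contourSumAdj n (fun κ y => c * ω κ y - a' * contourSum n A κ y) κ x
      = c * b κ x - a' * contourSumAdj n (contourSum n A) κ x := by
    intro κ x
    simp only [hbdef, AffineReproduction.contourSumAdj, Finset.sum_sub_distrib, Finset.mul_sum]
  refine ⟨fun κ x => ?_, ?_, fun y => ?_, fun κ y => rfl⟩
  · -- (el)
    rw [hΔμ, hφ, Pi.zero_apply, Pi.zero_apply, add_zero]
    have hneg : dz (fun p => -(r * Rf n a g p)) κ x = -(r * dz (Rf n a g) κ x) := by
      simp only [AffineAveraging.dz]; ring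
    rw [hneg, hE1 κ x]
    ring
  · -- (gauge)
    have hfun : curvAdj (curv A) = c • b - r • dz (Rf n a g) - a' • contourSumAdj n (contourSum n A) := by
      funext κ x
      simp only [Pi.sub_apply, Pi.smul_apply, smul_eq_mul]
      exact hE1 κ x
    have h0 := congrArg codiff₁ hfun
    rw [codiff₁_curvAdj, codiff₁_sub, codiff₁_sub, codiff₁_smul, codiff₁_smul, codiff₁_smul] at h0
    have hR : codiff₁ (dz (Rf n a g)) = codiff₁ (dz g) - codiff₁ (dz (Pf n a g)) := by
      rw [Rf_eq, dz_sub, codiff₁_sub]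
      rfl
    rw [hR] at h0
    have hsol : codiff₁ (dz g) = fun y => codiff₁ (dz (Pf n a g)) y + (c / r) * codiff₁ b y
        - (a' / r) * codiff₁ (contourSumAdj n (contourSum n A)) y := by
      funext y
      have := congr_fun h0 y
      simp only [Pi.zero_apply, Pi.sub_apply, Pi.smul_apply, smul_eq_mul] at this
      field_simp
      linarith
    show IsBlockConst n (codiff₁ (dz g))
    rw [hsol]
    refine isBlockConst_comb n ?_ ?_ ?_ (c / r) (a' / r)
    · exact isBlockConst_codiff₁_dz_Pf n a ha hg
    · rw [hbdef]; exact isBlockConst_codiff₁_contourSumAdj (N := n) _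
    · exact isBlockConst_codiff₁_contourSumAdj (N := n) _
  · -- (mean)
    rw [hμr]
    have h0 := blockSum_neg_sq_Gf_Rf n a ha hg y
    simp only [AffineAveraging.blockSum, Pi.smul_apply, smul_eq_mul] at h0 ⊢
    rw [← Finset.mul_sum, h0, mul_zero]

/-- [folklore] **THE WEIGHTED TRIPLE IS TEMPERED** (bounded). -/
theorem tempered_superposed_w (ha : 0 < a) (hGa : Decays Ga C δ) (hδ : 0 < δ) (hω : ∀ κ y, |ω κ y| ≤ Mω) :
    Tempered1 (kerOp₁ Ga (contourSumAdj n ω))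
      ∧ Tempered1 (fun κ y => c * ω κ y - a' * contourSum n (kerOp₁ Ga (contourSumAdj n ω)) κ y)
      ∧ Tempered0 (fun p => -(r * (n : ℝ) ^ 2) * Gf n a (Rf n a (codiff₁ (kerOp₁ Ga (contourSumAdj n ω)))) p) := by
  obtain ⟨tA, tφ, tμ⟩ := LandauDictionaryH.tempered_superposed n a (a' := a') (c := c) ha hGa hδ hω
  refine ⟨tA, tφ, ?_⟩
  obtain ⟨B, m, hB⟩ := tμ
  refine ⟨|r| * B, m, fun p => ?_⟩
  have h := hB p
  simp only at h ⊢
  rw [show -(r * (n : ℝ) ^ 2) * Gf n a (Rf n a (codiff₁ (kerOp₁ Ga (contourSumAdj n ω)))) p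
    = r * (-((n : ℝ) ^ 2) * Gf n a (Rf n a (codiff₁ (kerOp₁ Ga (contourSumAdj n ω)))) p) by ring, abs_mul]
  calc |r| * |(-((n : ℝ) ^ 2) * Gf n a (Rf n a (codiff₁ (kerOp₁ Ga (contourSumAdj n ω)))) p)| ≤ |r| * (B * (1 + l1 p) ^ m) :=
        mul_le_mul_of_nonneg_left h (abs_nonneg r)
    _ = |r| * B * (1 + l1 p) ^ m := by ring

end Solves

/-! ## §3 The tabled instance in the weighted shape: `wH = HRcol`, `wΦ = c•Cun − a′•δ`, `wM = r • muCol` -/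

section Main

variable {Ga Cun : MKer 4 (Fin 4)}

/-- [folklore] **BRICK B6 (DICT-H) IN THE OWNER's ρ-g5-5 SHAPE — `wH = Ga𝒬ᵀCun` (column `l`), `wΦ`, `wM = r • muCol`, CONDITIONAL ON the
weighted X₁a (`r ≠ 0`; truth `r = 2`, `a′ = 2a∕n⁸`, `c = 2`) ∧ (X₁b) `𝒬(HRcol) = δ_{(l,0)}`** — by `KKTFluctuationUnique.eq_wH_of_solvesKKT`.  NOTHING here
asserts X₁a∕X₁b. -/
theorem wH_eq_HRcol_w {r a' c : ℝ} (ha : 0 < a) (hr : r ≠ 0) (Ga Cun : MKer 4 (Fin 4)) (hGa : Spr Ga) (hCun : Spr Cun)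
    (hX1a : ∀ (m : Fin 4) (z : Site 4) (κ : Fin 4) (x : Site 4),
      curvAdj (curv (fun κ' p => Ga p z κ' m)) κ x = c * delta1 m z κ x - r * dz (Rf n a (codiff₁ (fun κ' p => Ga p z κ' m))) κ x
        - a' * contourSumAdj n (contourSum n (fun κ' p => Ga p z κ' m)) κ x)
    (hX1b : ∀ (l κ : Fin 4) (y : Site 4), contourSum n (HRcol n Ga Cun l 0) κ y = if y = 0 ∧ κ = l then 1 else 0)
    (l : Fin 4) :
    (fun κ z => wH (N := n) κ l z) = HRcol n Ga Cun l 0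
      ∧ (fun κ y => wΦ (N := n) κ l y) = (fun κ y => c * Cun y 0 κ l - a' * (if y = 0 ∧ κ = l then 1 else 0))
      ∧ wM (N := n) l = r • muCol n a Ga Cun l 0 := by
  have hμ := muCol_eq n a ha hGa hCun l 0
  obtain ⟨CG, δG, hδG, hG⟩ := hGa
  obtain ⟨CC, δC, hδC, hCk⟩ := hCun
  have hω : ∀ m y, |Cun y 0 m l| ≤ CC := fun m y => abs_Cun_le hCk hδC.le l 0 m y
  have hsol := solvesKKT_superposed_w n a (a' := a') (c := c) ha hr hG hδG hω hX1a
  obtain ⟨tA, tφ, tμ⟩ := tempered_superposed_w n a (r := r) (a' := a') (c := c) ha hG hδG hω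
  have hQ : contourSum n (kerOp₁ Ga (contourSumAdj n (fun m' y => Cun y 0 m' l))) = fun κ y => if y = 0 ∧ κ = l then (1 : ℝ) else 0 :=
    funext fun κ => funext fun y => hX1b l κ y
  rw [hQ] at hsol tφ
  have hμr : (fun p => -(r * (n : ℝ) ^ 2) * Gf n a (Rf n a (codiff₁ (kerOp₁ Ga (contourSumAdj n (fun m' y => Cun y 0 m' l))))) p)
      = r • muCol n a Ga Cun l 0 := by
    rw [hμ]
    funext p
    simp only [Pi.smul_apply, smul_eq_mul]
    show -(r * (n : ℝ) ^ 2) * Gf n a (Rf n a (codiff₁ (HRcol n Ga Cun l 0))) p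
      = r * (-((n : ℝ) ^ 2) * Gf n a (Rf n a (codiff₁ (HRcol n Ga Cun l 0))) p)
    ring
  rw [hμr] at hsol tμ
  obtain ⟨h1, h2, h3⟩ := eq_wH_of_solvesKKT (N := n) hsol tA tφ tμ
  exact ⟨h1.symm, h2.symm, h3.symm⟩

end Main

end

end Summit.QuantumFields.BalabanUV.Beta.D1BFx.LandauDictionaryHWeighted
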